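import Summits.QuantumFields.YangMills.Theorems.IR.BlockedActivityWTail
import HarnessLib

/-!
# Crux `IR` (stmt-QuantumFields-19354), lane B «strong coupling AFTER BLOCKING»: a certified TAIL DIGIT — Uc-grade mixing at mesh `b` ⇒ Uc-grade mixing at EVERY
# mesh `B ≥ 60·b` (every `β`)

Helper module for item `stmt-QuantumFields-19354` (`--supports`; it closes nothing), lane `ym-19354-onsetsc-p2` (g6); a digit for `univShellCond_coarsen_any` ∕
`univShellCond_tail_threshold` of `Theorems/IR/BlockedActivityWTail` (whose threshold `K₀` is obtained from a limit and is not explicit).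

* `digit_pow_four_le_two_pow` — `3552·(3j+3)⁴ ≤ 2^j` for `j ≥ 40` (base `3552·123⁴ = 813005348832 ≤ 2⁴⁰ = 1099511627776`; step `(x+3)⁴ ≤ 2x⁴` for `x ≥ 123`).
* ★ `univShellCond_tail_60` — for continuous `ρ` on a Hausdorff second-countable compact `G`: `UnivShellCond ρ β b 1 (1∕3552)` (`b ≥ 1`) ⇒ `UnivShellCond ρ β B 1 (1∕3552)` for EVERY
  `B ≥ 60·b` (`j = ⌊2(B∕b)∕3⌋ ≥ 40` bootstrap steps; tolerance `(2(B∕b)+1)⁴·2^{−j} ≤ (3j+3)⁴·2^{−j} ≤ 1∕3552`).  Compare the MULTIPLES digit `univShellCond_mul_53` (`53·b`).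

HONEST FRAMING: format bookkeeping; the universal shell condition at some mesh is ASSUMED; nothing about the onset at `b(β) ≍ ξ(β)`, a gap or Clay.  No `sorry`;
axioms ⊆ {propext, Classical.choice, Quot.sound}; no instances, no notation.
-/

set_option autoImplicit false

noncomputable section

open MeasureTheory
open Literature.MathematicalPhysics
open Literature.MathematicalPhysics.QuantumLattice
open Summit.QuantumFields.YangMills.Cruxes.IR.OnsetFormats (shellCount UnivShellCond)

namespace Summit.QuantumFields.YangMills.Cruxes.IR.BlockedActivity

/-- Arithmetic: `3552·(3j+3)⁴ ≤ 2^j` for `j ≥ 40` (base `3552·123⁴ = 813005348832 ≤ 2⁴⁰`; step factor `(x+3)⁴ ≤ 2x⁴` for `x ≥ 123`). -/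
theorem digit_pow_four_le_two_pow (j : ℕ) (hj : 40 ≤ j) : 3552 * (3 * j + 3) ^ 4 ≤ 2 ^ j := by
  induction j with
  | zero => omega
  | succ m ih =>
    rcases Nat.lt_or_ge m 40 with hm | hm
    · have : m = 39 := by omega
      subst this
      norm_num
    · have ih' := ih hm
      have hx : 123 ≤ 3 * m + 3 := by omega
      -- `(x+3)⁴ ≤ 2·x⁴` for `x = 3m+3 ≥ 123`
      have hstep : (3 * (m + 1) + 3) ^ 4 ≤ 2 * (3 * m + 3) ^ 4 := by
        set x := 3 * m + 3 with hxdef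
        have e : 3 * (m + 1) + 3 = x + 3 := by omega
        rw [e]
        have h3 : x ^ 3 * 123 ≤ x ^ 4 := by
          calc x ^ 3 * 123 ≤ x ^ 3 * x := Nat.mul_le_mul_left _ hx
            _ = x ^ 4 := by ring
        have h2 : x ^ 2 * 123 ≤ x ^ 3 := by
          calc x ^ 2 * 123 ≤ x ^ 2 * x := Nat.mul_le_mul_left _ hx
            _ = x ^ 3 := by ring
        have h1 : x * 123 ≤ x ^ 2 := by
          calc x * 123 ≤ x * x := Nat.mul_le_mul_left _ hx
            _ = x ^ 2 := by ring
        have hexp : (x + 3) ^ 4 = x ^ 4 + 12 * x ^ 3 + 54 * x ^ 2 + 108 * x + 81 := by ring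
        rw [hexp]
        nlinarith
      calc 3552 * (3 * (m + 1) + 3) ^ 4 ≤ 3552 * (2 * (3 * m + 3) ^ 4) := Nat.mul_le_mul_left _ hstep
        _ = 2 * (3552 * (3 * m + 3) ^ 4) := by ring
        _ ≤ 2 * 2 ^ m := Nat.mul_le_mul_left _ ih'
        _ = 2 ^ (m + 1) := by ring

section TailDigit

variable {G : Type} [Group G] [TopologicalSpace G] [IsTopologicalGroup G] [CompactSpace G] [MeasurableSpace G] [BorelSpace G]
  [SecondCountableTopology G] [T2Space G] {N : ℕ} (ρ : G →* Matrix (Fin N) (Fin N) ℂ)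

/-- ★ **TAIL DIGIT 60.**  For continuous `ρ`: Uc-grade mixing `UnivShellCond ρ β b 1 (1∕3552)` at a mesh `b ≥ 1` ⇒ `UnivShellCond ρ β B 1 (1∕3552)` at EVERY mesh `B ≥ 60·b`. -/
theorem univShellCond_tail_60 (hρ : Continuous ρ) {β : ℝ} {b : ℕ} (hb : 1 ≤ b) (hU : UnivShellCond ρ β b 1 (1 / 3552)) {B : ℕ} (hB : 60 * b ≤ B) :
    UnivShellCond ρ β B 1 (1 / 3552) := by
  have hK : 60 ≤ B / b := (Nat.le_div_iff_mul_le (by omega)).2 hB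
  have hbB : b ≤ B := le_trans (Nat.le_mul_of_pos_left b (by omega)) hB
  set K : ℕ := B / b with hKdef
  have hjK : 2 * K / 3 * 3 ≤ 2 * K := Nat.div_mul_le_self (2 * K) 3
  have hlt' : 2 * K < 2 * K / 3 * 3 + 3 := Nat.lt_div_mul_add (by norm_num)
  have hj40 : 40 ≤ 2 * K / 3 := (Nat.le_div_iff_mul_le (by norm_num)).2 (by omega)
  have h := univShellCond_coarsen_any ρ hρ hb (by norm_num) hU hbB (le_refl 1) (2 * K / 3) (by simpa using hjK)
  refine univShellCond_of_le ρ h ?_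
  set j : ℕ := 2 * K / 3 with hj
  have hθ : (1 / 3552 : ℝ) * shellCount 1 = 1 / 2 := by rw [shellCount_one]; norm_num
  rw [hθ]
  have hKj : 2 * K + 1 ≤ 3 * j + 3 := by omega
  have hdig := digit_pow_four_le_two_pow j hj40
  have h1 : (((2 * K + 1) ^ 4 : ℕ) : ℝ) ≤ (((3 * j + 3) ^ 4 : ℕ) : ℝ) := by exact_mod_cast Nat.pow_le_pow_left hKj 4
  have h2 : (3552 : ℝ) * (((3 * j + 3) ^ 4 : ℕ) : ℝ) ≤ (2 : ℝ) ^ j := by exact_mod_cast hdig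
  have hpow : (0 : ℝ) < (2 : ℝ) ^ j := by positivity
  have hhalf : ((1 : ℝ) / 2) ^ j = 1 / (2 : ℝ) ^ j := by rw [div_pow, one_pow]
  rw [hhalf]
  calc (((2 * K + 1) ^ 4 : ℕ) : ℝ) * (1 / (2 : ℝ) ^ j) ≤ (((3 * j + 3) ^ 4 : ℕ) : ℝ) * (1 / (2 : ℝ) ^ j) :=
        mul_le_mul_of_nonneg_right h1 (by positivity)
    _ = (((3 * j + 3) ^ 4 : ℕ) : ℝ) / (2 : ℝ) ^ j := by ring
    _ ≤ 1 / 3552 := by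
        rw [div_le_div_iff₀ hpow (by norm_num : (0 : ℝ) < 3552)]
        linarith

end TailDigit

end Summit.QuantumFields.YangMills.Cruxes.IR.BlockedActivity

end
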